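import Summits.ValiantsHypothesis.ValiantsHypothesis.Theorems.DefinabilityGapEdgeGates
import Summits.ValiantsHypothesis.ValiantsHypothesis.Theorems.DefinabilityGapMasonStothers
import HarnessLib

/-!
# Definability gap — `G_m` hits graphical ΣΠΣ(3) on every union support (`m ≥ 5`)

Helper-lane file F-M₂ of OFFER O-L5-MASON (decomp-val-lens-5 g39; RULING sub-scope (b): F-M split into
`DefinabilityGapEdgeGates` = F-M₁, imported, and THIS file) on the `KIPlantedHittingRO` helper lane
(`stmt-ValiantsHypothesis-23704`). A GRAPHICAL GATE is a product of differences `z_u − z_v` of block variables over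
an edge multiset `E` (`eprod E` of F-M₁; no data definition here). THEOREM ★ `kiPer_hits_graphicalThree`: for
`m ≥ 5`, three gates on ORIENTED edge multisets `E₁ E₂ E₃` (`u < v` lexicographically — one orientation per edge, no
loops) and ANY coefficients, `f := α₁·eprod E₁ + α₂·eprod E₂ + α₃·eprod E₃ ≠ 0 ⟹ f(G_m) ≠ 0`, where `G_m = φ` is
the Kabanets–Impagliazzo planted map `z_c ↦ P_c` (`bind₁ (kiPer m)`). No hypothesis on the union support:
triangles, `K₄`, any cycle structure are allowed — the first theorem of this road on CYCLIC union supports (the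
forest / matching theorems of `DefinabilityGapForestSums`, `DefinabilityGapMatchingSums`,
`DefinabilityGapThreeMatchings` need acyclic child → parent structure or matchings). The only identities are the
excluded `f = 0` themselves, e.g. the `K₄` three-matching identity `Δ₁₂Δ₃₄ − Δ₁₃Δ₂₄ + Δ₁₄Δ₂₃ = 0` and the triangle
`(a−b) + (b−c) + (c−a) = 0` (whereas `(a−b)³ + (b−c)³ + (c−a)³ = 3(a−b)(b−c)(c−a)` is NOT zero, and is hit).

## Proof (SIZE CLASSES, then the ENGINE `kiPer_threeGates_eqCard` for equal sizes `n`, induction on `n`)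

Sizes: `φ(eprod E)` is homogeneous of degree `|E|·m` and nonzero, so a size occurring once carries a zero
coefficient (`coeff_eq_zero_of_card_ne`, the shape of `DefinabilityGapThreeMatchings.coeff_eq_zero_of_card_ne`)
and two gates are the tree's ΣΠΣ(2) theorem (`kiPer_hits_twoGates` ← `kiPer_hits_sigmaPiSigmaTwo`, by name).
Equal sizes, all `αᵢ ≠ 0`, suppose `φ f = 0`: (E1) an edge common to the three gates is peeled off (induction, its
image `q_e ≠ 0`); (E2) an edge `e` in exactly two gates gives `q_e ∣ α_k φ(eprod E_k)` for the third — impossible,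
the images `q_e := P_u − P_v` being PRIME and RIGID on oriented edges (`prime_kiPer_sub`, `edge_eq_of_dvd`,
`not_dvd_kiPer_gate` of F-M₁ ← `prime_bind₁_kiPer_of_totalDegree_le_one`); (E3) pairwise edge-disjoint gates, the
FREE-FORM DICHOTOMY. Either some relabel-collapse `ρ_e : z_v ↦ z_u` (`e = (u, v)` an edge of `f`) leaves
`ρ_e f ≠ 0`: then `ρ_e` kills the gate containing `e` (a loop appears), the two other gates stay loopless and avoid
the merged block, and TWO GATES UNDER PATCHES (`bind₁_wordL_twoGates_ne_zero` of F-M₁, the seed-side merge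
`v → u` of `DefinabilityGapClusterMerging` / `DefinabilityGapForestSums`: SURVIVE `wordPoly_wordL_ne'`, KILL
`wordL_snd_eq`, TRANSFER `bind₁_wordL_ne_zero_of_cons`, CONTRACT `bind₁_wordL_rename_repL`; `2·3² = 18 < 25 ≤ m²`
is the only use of `m ≥ 5`) gives `φ_[e] (ρ_e f) ≠ 0`, while `φ_[e] ∘ ρ_e = φ_[e]` and `φ f = 0 ⟹ φ_[e] f = 0`
(`bind₁_wordL_eq_zero_of_kiPer`) — contradiction. Or NO collapse is free: then by the multivariate FACTOR THEOREM
every `X v − X u` divides `f`, so the number `N` of distinct edges is `≤ deg f ≤ n`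
(`card_le_totalDegree_of_rename_eq_zero`), while MASON–STOTHERS for the three coprime products of the pairwise
non-associated degree-`m` primes `q_e` (`masonStothers_three` of `DefinabilityGapMasonStothers`, whose Wronskian
certificate rests on `eq_C_of_forall_pderiv_eq_zero` / `totalDegree_pderiv_lt`) gives `m·n < m·N` — contradiction.

WHY `k = 3` ONLY. For `k ≥ 4` gates the Mason–Stothers constant `(k−1)(k−2)/2 ≥ 3` turns `n < N` into
`n ≤ 3(N−1)`, compatible with `N ≤ n`; and recursing the free branch one level down lands on `k − 1 ≥ 3` gates under
a PATCHED word family, whose images no longer lie in one prime pencil (Mason–Stothers over a patched pencil is not in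
the tree). So fan-in `≥ 4` on cyclic supports is NOT claimed, nor are affine non-graphical gates or the leaf regime.

HONEST BOUNDARY: graphical gates of top fan-in 3 only (products of differences z_u − z_v over ORIENTED edge
multisets), m ≥ 5; graphical fan-in ≥ 4 on cyclic union supports, affine non-graphical gates (β) and the leaf regime
(γ) are NOT claimed and no road to them is offered (the k-term Mason constant (k−1)(k−2)/2 ≥ 3 defeats the count for
k ≥ 4; the free-form recursion one level down would need Mason–Stothers over a PATCHED pencil, not in tree);
0 S-currency; closes NO item; K1 / stmt-23704 text / VP ≠ VNP untouched.

ELEMENTARY · NEW-COMBINATION (one lever new to the programme: the y-side Mason–Stothers count on the images of the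
prime pencil, meeting the z-side seed-merge at the factor theorem) · INCOMPARABLE with `kiPer_hits_matchingSums` /
`kiPer_hits_forestSums` (every fan-in `k`, restricted supports; neither implies the other) · the `m ≥ 6`
matching theorem `kiPer_hits_threeMatchings` is NOT re-derived · 0 S-currency · closes NO item. BY-NAME reuse, no re-proofs,
no edits of tree files: `kiPer_hits_sigmaPiSigmaTwo` (`DefinabilityGapSigmaPiSigmaTwo`), `kiPer_isHomogeneous`
(`DefinabilityGapAffineRung`), `repL`, `bind₁_wordL_eq_zero_of_kiPer` (`DefinabilityGapClusterMerging`),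
`card_le_totalDegree_of_rename_eq_zero`, `masonStothers_three` (`DefinabilityGapMasonStothers`), and § 1–3 of
`DefinabilityGapEdgeGates`. Citations in prose only: Kabanets–Impagliazzo 2003, Nisan–Wigderson 1994 (the lane);
Stothers 1981, Mason 1984, Saxena–Seshadhri 2013 (the certificate's print context).
-/

noncomputable section

open MvPolynomial
open Summit.ValiantsHypothesis.ValiantsHypothesis.Theorems.DefinabilityGapAffineRung
open Summit.ValiantsHypothesis.ValiantsHypothesis.Theorems.DefinabilityGapBlockMerging
open Summit.ValiantsHypothesis.ValiantsHypothesis.Theorems.DefinabilityGapClusterMerging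
open Summit.ValiantsHypothesis.ValiantsHypothesis.Theorems.DefinabilityGapSigmaPiSigmaTwo
open Summit.ValiantsHypothesis.ValiantsHypothesis.Theorems.DefinabilityGapMasonStothers
open Summit.ValiantsHypothesis.ValiantsHypothesis.Theorems.DefinabilityGapEdgeGates

set_option linter.dupNamespace false

namespace Summit.ValiantsHypothesis.ValiantsHypothesis.Theorems.DefinabilityGapGraphicalThree

variable {m : ℕ}

/-! ## 1. Sizes: two gates, and a size occurring once -/

/-- (B) two gates: `kiPer_hits_sigmaPiSigmaTwo` repackaged. [this file] -/
theorem kiPer_hits_twoGates (hm : 3 ≤ m) (A B : Multiset ((Fin 3 → Fin (qOf m)) × (Fin 3 → Fin (qOf m))))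
    (β γ : ℂ) (h : C β * eprod A + C γ * eprod B ≠ 0) : bind₁ (kiPer m) (C β * eprod A + C γ * eprod B) ≠ 0 := by
  have key : ∀ (N : Multiset ((Fin 3 → Fin (qOf m)) × (Fin 3 → Fin (qOf m)))) (δ : ℂ),
      C δ * eprod N = (C δ ::ₘ N.map fun e => X e.1 - X e.2).prod ∧
        ∀ p ∈ (C δ ::ₘ N.map fun e => X e.1 - X e.2), p.totalDegree ≤ 1 := by
    intro N δ
    refine ⟨by rw [Multiset.prod_cons, eprod], fun p hp => ?_⟩
    rcases Multiset.mem_cons.1 hp with hp | hp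
    · rw [hp, totalDegree_C]; exact Nat.zero_le 1
    · obtain ⟨e, _, rfl⟩ := Multiset.mem_map.1 hp
      exact totalDegree_X_sub_X_le_one e.1 e.2
  obtain ⟨e₁, d₁⟩ := key A β
  obtain ⟨e₂, d₂⟩ := key B γ
  rw [e₁, e₂] at h ⊢
  exact kiPer_hits_sigmaPiSigmaTwo hm _ _ d₁ d₂ h

/-- (B) size classes: a size occurring once carries a zero coefficient — read the degree-`m|E₃|` component.
[this file] -/
theorem coeff_eq_zero_of_card_ne (hm : 3 ≤ m)
    {E₁ E₂ E₃ : Multiset ((Fin 3 → Fin (qOf m)) × (Fin 3 → Fin (qOf m)))}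
    (hE₃ : ∀ e ∈ E₃, e.1 ≠ e.2) (h₁ : Multiset.card E₃ ≠ Multiset.card E₁)
    (h₂ : Multiset.card E₃ ≠ Multiset.card E₂) {γ₁ γ₂ γ₃ : ℂ}
    (h : bind₁ (kiPer m) (C γ₁ * eprod E₁ + C γ₂ * eprod E₂ + C γ₃ * eprod E₃) = 0) : γ₃ = 0 := by
  have hm0 : 0 < m := by omega
  have key : ∀ (N : Multiset ((Fin 3 → Fin (qOf m)) × (Fin 3 → Fin (qOf m)))) (γ : ℂ),
      homogeneousComponent (Multiset.card E₃ * m) (bind₁ (kiPer m) (C γ * eprod N)) =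
        if Multiset.card E₃ * m = Multiset.card N * m then C γ * bind₁ (kiPer m) (eprod N) else 0 := by
    intro N γ
    rw [map_mul, bind₁_C_right, homogeneousComponent_C_mul,
      homogeneousComponent_of_mem (isHomogeneous_kiPer_eprod N), mul_ite, mul_zero]
  have hc := congrArg (homogeneousComponent (Multiset.card E₃ * m)) h
  rw [map_add, map_add, map_add, map_add, map_zero, key, key, key,
    if_neg (fun e => h₁ (Nat.eq_of_mul_eq_mul_right hm0 e)),
    if_neg (fun e => h₂ (Nat.eq_of_mul_eq_mul_right hm0 e)),
    if_pos (rfl : Multiset.card E₃ * m = Multiset.card E₃ * m), zero_add, zero_add] at hc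
  exact (mul_eq_zero.1 hc).elim (fun h' => C_eq_zero.1 h') fun h' => absurd h' (kiPer_eprod_ne_zero hm hE₃)

/-! ## 2. The engine: three gates of one size -/

/-- (E) ENGINE, equal sizes `n`, by induction on `n`: zero coefficient → two gates; a common edge is peeled (E1); an
edge in exactly two gates is excluded by prime avoidance (E2); for pairwise edge-disjoint gates either a free collapse
`ρ_e` feeds TWO GATES UNDER PATCHES (E3a), or the factor count `N ≤ deg f ≤ n` meets Mason–Stothers `n < N` (E3b).
[this file] -/
theorem kiPer_threeGates_eqCard (hm : 5 ≤ m) (n : ℕ) :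
    ∀ (E₁ E₂ E₃ : Multiset ((Fin 3 → Fin (qOf m)) × (Fin 3 → Fin (qOf m)))) (α₁ α₂ α₃ : ℂ),
      Multiset.card E₁ = n → Multiset.card E₂ = n → Multiset.card E₃ = n →
      (∀ e ∈ E₁, toLex e.1 < toLex e.2) → (∀ e ∈ E₂, toLex e.1 < toLex e.2) →
      (∀ e ∈ E₃, toLex e.1 < toLex e.2) →
      C α₁ * eprod E₁ + C α₂ * eprod E₂ + C α₃ * eprod E₃ ≠ 0 →
      bind₁ (kiPer m) (C α₁ * eprod E₁ + C α₂ * eprod E₂ + C α₃ * eprod E₃) ≠ 0 := by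
  have hm3 : 3 ≤ m := by omega
  have hm0 : 0 < m := by omega
  -- (E2) an edge in exactly two of the gates: `q_e` would divide the third term
  have hE2 : ∀ (F₁ F₂ F₃ : Multiset ((Fin 3 → Fin (qOf m)) × (Fin 3 → Fin (qOf m)))) (γ₁ γ₂ γ₃ : ℂ),
      (∀ e ∈ F₃, toLex e.1 < toLex e.2) → γ₃ ≠ 0 →
      ∀ e : (Fin 3 → Fin (qOf m)) × (Fin 3 → Fin (qOf m)), toLex e.1 < toLex e.2 → e ∈ F₁ → e ∈ F₂ → e ∉ F₃ →
      bind₁ (kiPer m) (C γ₁ * eprod F₁ + C γ₂ * eprod F₂ + C γ₃ * eprod F₃) ≠ 0 := by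
    intro F₁ F₂ F₃ γ₁ γ₂ γ₃ ho₃ hγ₃ e he he₁ he₂ he₃ h0
    have hdvd : ∀ (F : Multiset ((Fin 3 → Fin (qOf m)) × (Fin 3 → Fin (qOf m)))) (γ : ℂ), e ∈ F →
        kiPer m e.1 - kiPer m e.2 ∣ bind₁ (kiPer m) (C γ * eprod F) := by
      intro F γ heF
      rw [map_mul, bind₁_eprod]
      exact Dvd.dvd.mul_left (Multiset.dvd_prod (Multiset.mem_map.2 ⟨e, heF, rfl⟩)) _
    rw [map_add, map_add] at h0
    have h3 : kiPer m e.1 - kiPer m e.2 ∣ bind₁ (kiPer m) (C γ₃ * eprod F₃) := by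
      have e3 : bind₁ (kiPer m) (C γ₃ * eprod F₃) =
          -(bind₁ (kiPer m) (C γ₁ * eprod F₁) + bind₁ (kiPer m) (C γ₂ * eprod F₂)) := by
        linear_combination h0
      rw [e3, dvd_neg]
      exact dvd_add (hdvd F₁ γ₁ he₁) (hdvd F₂ γ₂ he₂)
    rw [map_mul, bind₁_C_right] at h3
    exact not_dvd_kiPer_gate hm3 he ho₃ he₃ hγ₃ h3
  -- (E3a) a FREE collapse `ρ_e`, `e ∈ F₁`, `F₁` edge-disjoint from `F₂`, `F₃`: two gates under the patch `[e]`
  have hE3a : ∀ (F₁ F₂ F₃ : Multiset ((Fin 3 → Fin (qOf m)) × (Fin 3 → Fin (qOf m)))) (γ₁ γ₂ γ₃ : ℂ),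
      (∀ e ∈ F₁, toLex e.1 < toLex e.2) → (∀ e ∈ F₂, toLex e.1 < toLex e.2) →
      (∀ e ∈ F₃, toLex e.1 < toLex e.2) → (∀ e ∈ F₁, e ∉ F₂) → (∀ e ∈ F₁, e ∉ F₃) →
      ∀ e ∈ F₁, rename (repL [e]) (C γ₁ * eprod F₁ + C γ₂ * eprod F₂ + C γ₃ * eprod F₃) ≠ 0 →
      bind₁ (kiPer m) (C γ₁ * eprod F₁ + C γ₂ * eprod F₂ + C γ₃ * eprod F₃) ≠ 0 := by
    intro F₁ F₂ F₃ γ₁ γ₂ γ₃ ho₁ ho₂ ho₃ h₁₂ h₁₃ e he₁ hρ h0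
    have he : toLex e.1 < toLex e.2 := ho₁ e he₁
    have hne : e.1 ≠ e.2 := fun h => he.ne (congrArg toLex h)
    have hrep : ∀ c : Fin 3 → Fin (qOf m), repL [e] c = if c = e.2 then e.1 else c := fun c => rfl
    -- the collapse kills the gate of `F₁` (a loop appears) and relabels the two others
    have hloop : (e.1, e.1) ∈ F₁.map fun e' => (repL [e] e'.1, repL [e] e'.2) := by
      refine Multiset.mem_map.2 ⟨e, he₁, ?_⟩
      show (repL [e] e.1, repL [e] e.2) = (e.1, e.1)
      rw [hrep, hrep, if_neg hne, if_pos rfl]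
    have hρf : rename (repL [e]) (C γ₁ * eprod F₁ + C γ₂ * eprod F₂ + C γ₃ * eprod F₃) =
        C γ₂ * eprod (F₂.map fun e' => (repL [e] e'.1, repL [e] e'.2)) +
          C γ₃ * eprod (F₃.map fun e' => (repL [e] e'.1, repL [e] e'.2)) := by
      rw [map_add, map_add, map_mul, map_mul, map_mul, rename_C, rename_C, rename_C, rename_eprod,
        rename_eprod, rename_eprod, eprod_eq_zero_of_mem hloop, mul_zero, zero_add]
    -- the relabelled edges of `F₂`, `F₃` are loopless and avoid the merged block `e.2`
    have hlive : ∀ d' ∈ F₂.map (fun e' => (repL [e] e'.1, repL [e] e'.2)) +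
          F₃.map (fun e' => (repL [e] e'.1, repL [e] e'.2)),
        d'.1 ≠ d'.2 ∧ (∀ p ∈ [e], d'.1 ≠ p.2) ∧ ∀ p ∈ [e], d'.2 ≠ p.2 := by
      intro d' hd'
      rw [← Multiset.map_add] at hd'
      obtain ⟨d, hd, rfl⟩ := Multiset.mem_map.1 hd'
      have hdo : toLex d.1 < toLex d.2 := by
        rcases Multiset.mem_add.1 hd with h | h
        · exact ho₂ d h
        · exact ho₃ d h
      have hde : d ≠ e := by
        intro hde
        rw [hde] at hd
        rcases Multiset.mem_add.1 hd with h | h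
        · exact h₁₂ e he₁ h
        · exact h₁₃ e he₁ h
      have hdne : d.1 ≠ d.2 := fun h => hdo.ne (congrArg toLex h)
      have hlv : ∀ x : Fin 3 → Fin (qOf m), ∀ p ∈ [e], (if x = e.2 then e.1 else x) ≠ p.2 := by
        intro x p hp
        rw [List.mem_singleton.1 hp]
        by_cases hx : x = e.2
        · rw [if_pos hx]; exact hne
        · rw [if_neg hx]; exact hx
      show repL [e] d.1 ≠ repL [e] d.2 ∧ (∀ p ∈ [e], repL [e] d.1 ≠ p.2) ∧ ∀ p ∈ [e], repL [e] d.2 ≠ p.2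
      rw [hrep, hrep]
      refine ⟨?_, hlv d.1, hlv d.2⟩
      by_cases h1 : d.1 = e.2
      · have h2 : ¬ d.2 = e.2 := fun h2 => hdne (h1.trans h2.symm)
        rw [if_pos h1, if_neg h2]
        intro h
        rw [h1, ← h] at hdo
        exact lt_asymm he hdo
      · by_cases h2 : d.2 = e.2
        · rw [if_neg h1, if_pos h2]
          exact fun h => hde (Prod.ext h h2)
        · rw [if_neg h1, if_neg h2]; exact hdne
    have h18 : 2 * 3 ^ ([e].length + 1) < m * m :=
      lt_of_lt_of_le (by rw [List.length_singleton]; norm_num) (Nat.mul_le_mul hm hm)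
    refine bind₁_wordL_twoGates_ne_zero (List.pairwise_singleton _ e) h18 _ _ γ₂ γ₃ hlive ?_ ?_
    · rw [← hρf]; exact hρ
    · rw [← hρf, bind₁_wordL_rename_repL (List.mem_singleton_self e), bind₁_wordL_eq_zero_of_kiPer [e] h0]
  induction n with
  | zero =>
    intro E₁ E₂ E₃ α₁ α₂ α₃ c₁ c₂ c₃ _ _ _ hf
    rw [Multiset.card_eq_zero] at c₁ c₂ c₃
    rw [c₁, c₂, c₃, eprod_zero, mul_one, mul_one, mul_one, ← C_add, ← C_add] at hf ⊢
    rw [bind₁_C_right]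
    exact MvPolynomial.C_ne_zero.2 (MvPolynomial.C_ne_zero.1 hf)
  | succ n ih =>
    intro E₁ E₂ E₃ α₁ α₂ α₃ c₁ c₂ c₃ ho₁ ho₂ ho₃ hf
    -- (E0) a zero coefficient: two gates
    by_cases hα₁ : α₁ = 0
    · rw [hα₁, C_0, zero_mul, zero_add] at hf ⊢; exact kiPer_hits_twoGates hm3 E₂ E₃ α₂ α₃ hf
    by_cases hα₂ : α₂ = 0
    · rw [hα₂, C_0, zero_mul, add_zero] at hf ⊢; exact kiPer_hits_twoGates hm3 E₁ E₃ α₁ α₃ hf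
    by_cases hα₃ : α₃ = 0
    · rw [hα₃, C_0, zero_mul, add_zero] at hf ⊢; exact kiPer_hits_twoGates hm3 E₁ E₂ α₁ α₂ hf
    -- (E1) an edge common to the three gates is peeled off
    by_cases hcom : ∃ e ∈ E₁, e ∈ E₂ ∧ e ∈ E₃
    · obtain ⟨e, he₁, he₂, he₃⟩ := hcom
      have hne : e.1 ≠ e.2 := fun h => (ho₁ e he₁).ne (congrArg toLex h)
      obtain ⟨E₁', rfl⟩ := Multiset.exists_cons_of_mem he₁
      obtain ⟨E₂', rfl⟩ := Multiset.exists_cons_of_mem he₂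
      obtain ⟨E₃', rfl⟩ := Multiset.exists_cons_of_mem he₃
      have hfac : C α₁ * eprod (e ::ₘ E₁') + C α₂ * eprod (e ::ₘ E₂') + C α₃ * eprod (e ::ₘ E₃') =
          (X e.1 - X e.2) * (C α₁ * eprod E₁' + C α₂ * eprod E₂' + C α₃ * eprod E₃') := by
        rw [eprod_cons, eprod_cons, eprod_cons]; ring
      rw [hfac] at hf ⊢
      rw [map_mul, bind₁_kiPer_X_sub_X]
      rw [Multiset.card_cons] at c₁ c₂ c₃
      exact mul_ne_zero (prime_kiPer_sub hm3 hne).ne_zero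
        (ih E₁' E₂' E₃' α₁ α₂ α₃ (by omega) (by omega) (by omega)
          (fun e' he' => ho₁ e' (Multiset.mem_cons_of_mem he'))
          (fun e' he' => ho₂ e' (Multiset.mem_cons_of_mem he'))
          (fun e' he' => ho₃ e' (Multiset.mem_cons_of_mem he')) (right_ne_zero_of_mul hf))
    -- no common edge; suppose `φ f = 0`
    intro h0
    have h0₂ : bind₁ (kiPer m) (C α₂ * eprod E₂ + C α₃ * eprod E₃ + C α₁ * eprod E₁) = 0 := by
      rw [← add_rotate]; exact h0
    have h0₃ : bind₁ (kiPer m) (C α₃ * eprod E₃ + C α₁ * eprod E₁ + C α₂ * eprod E₂) = 0 := by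
      rw [add_rotate]; exact h0
    -- (E2) the gates are pairwise edge-disjoint
    have h₁₂ : ∀ e ∈ E₁, e ∉ E₂ := fun e he₁ he₂ =>
      hE2 E₁ E₂ E₃ α₁ α₂ α₃ ho₃ hα₃ e (ho₁ e he₁) he₁ he₂ (fun he₃ => hcom ⟨e, he₁, he₂, he₃⟩) h0
    have h₂₃ : ∀ e ∈ E₂, e ∉ E₃ := fun e he₂ he₃ =>
      hE2 E₂ E₃ E₁ α₂ α₃ α₁ ho₁ hα₁ e (ho₂ e he₂) he₂ he₃ (fun he₁ => hcom ⟨e, he₁, he₂, he₃⟩) h0₂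
    have h₁₃ : ∀ e ∈ E₁, e ∉ E₃ := fun e he₁ he₃ =>
      hE2 E₃ E₁ E₂ α₃ α₁ α₂ ho₂ hα₂ e (ho₃ e he₃) he₃ he₁ (fun he₂ => hcom ⟨e, he₁, he₂, he₃⟩) h0₃
    -- (E3a) a free collapse
    by_cases hfree : ∃ e ∈ E₁ + E₂ + E₃,
        rename (repL [e]) (C α₁ * eprod E₁ + C α₂ * eprod E₂ + C α₃ * eprod E₃) ≠ 0
    · obtain ⟨e, he, hρ⟩ := hfree
      rcases Multiset.mem_add.1 he with he | he₃
      · rcases Multiset.mem_add.1 he with he₁ | he₂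
        · exact hE3a E₁ E₂ E₃ α₁ α₂ α₃ ho₁ ho₂ ho₃ h₁₂ h₁₃ e he₁ hρ h0
        · refine hE3a E₂ E₃ E₁ α₂ α₃ α₁ ho₂ ho₃ ho₁ h₂₃ (fun e' he₂' he₁' => h₁₂ e' he₁' he₂') e he₂ ?_ h0₂
          rw [← add_rotate]; exact hρ
      · refine hE3a E₃ E₁ E₂ α₃ α₁ α₂ ho₃ ho₁ ho₂ (fun e' he₃' he₁' => h₁₃ e' he₁' he₃')
          (fun e' he₃' he₂' => h₂₃ e' he₂' he₃') e he₃ ?_ h0₃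
        rw [add_rotate]; exact hρ
    -- (E3b) no free collapse: the factor count against Mason–Stothers
    have hall : ∀ e ∈ E₁ + E₂ + E₃,
        rename (repL [e]) (C α₁ * eprod E₁ + C α₂ * eprod E₂ + C α₃ * eprod E₃) = 0 := by
      intro e he
      by_contra h
      exact hfree ⟨e, he, h⟩
    have hoS : ∀ e ∈ E₁ + E₂ + E₃, toLex e.1 < toLex e.2 := by
      intro e he
      rcases Multiset.mem_add.1 he with he | he
      · rcases Multiset.mem_add.1 he with he | he
        · exact ho₁ e he
        · exact ho₂ e he
      · exact ho₃ e he
    have hlS : ∀ e ∈ E₁ + E₂ + E₃, e.1 ≠ e.2 := fun e he h => (hoS e he).ne (congrArg toLex h)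
    have hN : (E₁ + E₂ + E₃).toFinset.card ≤
        (C α₁ * eprod E₁ + C α₂ * eprod E₂ + C α₃ * eprod E₃).totalDegree :=
      card_le_totalDegree_of_rename_eq_zero _ hf (fun e he => hlS e (Multiset.mem_toFinset.1 he))
        (fun e he e' he' _ h => by
          have h1 := hoS e (Multiset.mem_toFinset.1 he)
          rw [h] at h1
          exact lt_asymm (hoS e' (Multiset.mem_toFinset.1 he')) h1)
        (fun e he => by
          have hρ : (fun c : Fin 3 → Fin (qOf m) => if c = e.2 then e.1 else c) = repL [e] :=
            funext fun c => rfl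
          rw [hρ]; exact hall e (Multiset.mem_toFinset.1 he))
    have hdeg : (C α₁ * eprod E₁ + C α₂ * eprod E₂ + C α₃ * eprod E₃).totalDegree ≤ n + 1 := by
      have hg : ∀ (F : Multiset ((Fin 3 → Fin (qOf m)) × (Fin 3 → Fin (qOf m)))) (γ : ℂ),
          Multiset.card F = n + 1 → (C γ * eprod F).totalDegree ≤ n + 1 := fun F γ hF =>
        (totalDegree_mul _ _).trans (by rw [totalDegree_C, zero_add, ← hF]; exact totalDegree_eprod_le F)
      exact (totalDegree_add _ _).trans (max_le ((totalDegree_add _ _).trans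
        (max_le (hg E₁ α₁ c₁) (hg E₂ α₂ c₂))) (hg E₃ α₃ c₃))
    have hsum : C α₁ * (E₁.map fun e : (Fin 3 → Fin (qOf m)) × (Fin 3 → Fin (qOf m)) =>
          kiPer m e.1 - kiPer m e.2).prod +
        C α₂ * (E₂.map fun e : (Fin 3 → Fin (qOf m)) × (Fin 3 → Fin (qOf m)) => kiPer m e.1 - kiPer m e.2).prod +
        C α₃ * (E₃.map fun e : (Fin 3 → Fin (qOf m)) × (Fin 3 → Fin (qOf m)) => kiPer m e.1 - kiPer m e.2).prod
          = 0 := by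
      rw [map_add, map_add, map_mul, map_mul, map_mul, bind₁_C_right, bind₁_C_right, bind₁_C_right,
        bind₁_eprod, bind₁_eprod, bind₁_eprod] at h0
      exact h0
    have hM := masonStothers_three
      (fun e : (Fin 3 → Fin (qOf m)) × (Fin 3 → Fin (qOf m)) => kiPer m e.1 - kiPer m e.2) hm0 (Nat.succ_pos n)
      E₁ E₂ E₃ (fun i hi => prime_kiPer_sub hm3 (hlS i hi))
      (fun i _ => (kiPer_isHomogeneous i.1).sub (kiPer_isHomogeneous i.2))
      (fun i hi j hj h => edge_eq_of_dvd hm3 (hoS i hi) (hoS j hj) h) h₁₂ h₁₃ h₂₃ c₁ c₂ c₃ hα₁ hα₂ hα₃ hsum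
    exact absurd hM (not_lt.2 (Nat.mul_le_mul_left m (hN.trans hdeg)))

/-! ## 3. The theorem -/

/-- ★ GRAPHICAL ΣΠΣ(3) ON EVERY UNION SUPPORT (`m ≥ 5`): for ORIENTED edge multisets `E₁ E₂ E₃` and any
coefficients, `α₁·eprod E₁ + α₂·eprod E₂ + α₃·eprod E₃ ≠ 0 ⟹ φ(α₁·eprod E₁ + α₂·eprod E₂ + α₃·eprod E₃) ≠ 0`.
SIZE CLASSES (`coeff_eq_zero_of_card_ne`, `kiPer_hits_twoGates`), then the ENGINE. HONEST BOUNDARY: top fan-in 3,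
graphical gates, oriented edges; fan-in ≥ 4 on cyclic supports, affine gates, the leaf regime are NOT claimed;
INCOMPARABLE with the forest / matching theorems; 0 S-currency; closes NO item. [this file] -/
theorem kiPer_hits_graphicalThree (hm : 5 ≤ m)
    {E₁ E₂ E₃ : Multiset ((Fin 3 → Fin (qOf m)) × (Fin 3 → Fin (qOf m)))}
    (ho₁ : ∀ e ∈ E₁, toLex e.1 < toLex e.2) (ho₂ : ∀ e ∈ E₂, toLex e.1 < toLex e.2)
    (ho₃ : ∀ e ∈ E₃, toLex e.1 < toLex e.2) {α₁ α₂ α₃ : ℂ}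
    (hf : C α₁ * eprod E₁ + C α₂ * eprod E₂ + C α₃ * eprod E₃ ≠ 0) :
    bind₁ (kiPer m) (C α₁ * eprod E₁ + C α₂ * eprod E₂ + C α₃ * eprod E₃) ≠ 0 := by
  have hm3 : 3 ≤ m := by omega
  -- a size occurring once (`F₃`) carries a zero coefficient; the two other gates are ΣΠΣ(2)
  have hU : ∀ (F₁ F₂ F₃ : Multiset ((Fin 3 → Fin (qOf m)) × (Fin 3 → Fin (qOf m)))) (γ₁ γ₂ γ₃ : ℂ),
      (∀ e ∈ F₃, e.1 ≠ e.2) → Multiset.card F₃ ≠ Multiset.card F₁ → Multiset.card F₃ ≠ Multiset.card F₂ →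
      C γ₁ * eprod F₁ + C γ₂ * eprod F₂ + C γ₃ * eprod F₃ ≠ 0 →
      bind₁ (kiPer m) (C γ₁ * eprod F₁ + C γ₂ * eprod F₂ + C γ₃ * eprod F₃) ≠ 0 := by
    intro F₁ F₂ F₃ γ₁ γ₂ γ₃ hF₃ h₁ h₂ hf h0
    have hγ₃ := coeff_eq_zero_of_card_ne hm3 hF₃ h₁ h₂ h0
    rw [hγ₃, C_0, zero_mul, add_zero] at hf h0
    exact kiPer_hits_twoGates hm3 F₁ F₂ γ₁ γ₂ hf h0
  have hl₁ : ∀ e ∈ E₁, e.1 ≠ e.2 := fun e he h => (ho₁ e he).ne (congrArg toLex h)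
  have hl₂ : ∀ e ∈ E₂, e.1 ≠ e.2 := fun e he h => (ho₂ e he).ne (congrArg toLex h)
  have hl₃ : ∀ e ∈ E₃, e.1 ≠ e.2 := fun e he h => (ho₃ e he).ne (congrArg toLex h)
  by_cases h12 : Multiset.card E₁ = Multiset.card E₂
  · by_cases h23 : Multiset.card E₂ = Multiset.card E₃
    · exact kiPer_threeGates_eqCard hm _ E₁ E₂ E₃ α₁ α₂ α₃ rfl h12.symm (h12.trans h23).symm ho₁ ho₂ ho₃ hf
    · exact hU E₁ E₂ E₃ α₁ α₂ α₃ hl₃ (fun h => h23 (h12.symm.trans h.symm)) (fun h => h23 h.symm) hf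
  · by_cases h13 : Multiset.card E₁ = Multiset.card E₃
    · rw [add_rotate, add_rotate] at hf ⊢
      exact hU E₃ E₁ E₂ α₃ α₁ α₂ hl₂ (fun h => h12 (h13.trans h.symm)) (fun h => h12 h.symm) hf
    · by_cases h23 : Multiset.card E₂ = Multiset.card E₃
      · rw [add_rotate] at hf ⊢
        exact hU E₂ E₃ E₁ α₂ α₃ α₁ hl₁ h12 h13 hf
      · exact hU E₁ E₂ E₃ α₁ α₂ α₃ hl₃ (fun h => h13 h.symm) (fun h => h23 h.symm) hf

end Summit.ValiantsHypothesis.ValiantsHypothesis.Theorems.DefinabilityGapGraphicalThree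

end
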